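import Summits.ResolutionOfSingularities.ResolutionOfSingularities.Theorems.FrobeniusLadderFInjectiveMacaulayficationFDStorey1PFedder
import HarnessLib

/-!
# (W-TD) BED D: the COORDINATE CHANGE between storey 1ʼs chart 277 and the storey-2 presentation — `k[Y]/(g₂₇₇) ≃ k[Y]/(G)` by the involution `Y₂ ↦ Y₂ + 1`, sending `𝔪̄_P` to
# the origin (crux `FInjectiveMacaulayfication` stmt-ResolutionOfSingularities-15315, chain w45a; res-L1-w45a-plan-1 RULING R21.32 (2) «COORDINATE HANDSHAKE: stub-2ʼs chart-277 ring is
# k[Y0..Y4]/(g₂₇₇), g₂₇₇ = Y2² + Y2Y3Y4⁴ + 1 + Y1³ + Y0³ + Y2Y3²Y4, P₀ = (Y0, Y1, Y2+1, Y3, Y4) — UNTRANSLATED; stub-3ʼs storey-2 specimen is G at the ORIGIN — TRANSLATED; stub-1: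
# the assembly carries the explicit isomorphism» and R21.34 (c); seat res-L1-w45a-stub-1 g13; data: res-L1-w45a-stub-2ʼs ✓ `FDStorey1PIdeal` (τ, `𝔪_P`, `G_P`) and
# res-L1-w45a-stub-3ʼs ✓ `FDStorey2Specimen` (G = X2² + X0³ + X1³ + X3X4⁴ + X3²X4 + X2X3X4⁴ + X2X3²X4))

[OURS · L1 W4.5a] Support file (`--supports stmt-ResolutionOfSingularities-15315 --as helper`); def-free; UNCONDITIONAL; no named fact; NOT a statement of any manuscript.
Nothing of the crux is proved. AI-written (AI review is weaker than expert review).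

* (chart-277 strict transform `g₂₇₇ = Y₂² + Y₂Y₃Y₄⁴ + 1 + Y₁³ + Y₀³ + Y₂Y₃²Y₄`: res-L1-w45a-stub-2ʼs ✓ `FDStorey1PFedder.evalL_G277`.)
* ★ `tau_evalL_G277` — `τ(g₂₇₇) = G` in characteristic 2, `τ : Y₂ ↦ Y₂ + 1` (`FDStorey1PIdeal`ʼs involution), `G` = `FDStorey2Specimen`ʼs polynomial.
* ★★ `exists_chartEquiv` — a ring isomorphism `σ : k[Y]/(g₂₇₇) ≃+* k[Y]/(G)` with `σ ∘ mk = mk ∘ τ`, mapping the point ideal `𝔪̄_P = (Y₀,Y₁,Y₂+1,Y₃,Y₄)·k[Y]/(g₂₇₇)` ONTO the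
  origin ideal `(Ȳ₀,…,Ȳ₄)`; `comap_chartEquiv_origin` — hence `σ⁻¹(origin) = 𝔪̄_P` as points (the `hQ` input of ✓ `FHalfRowOfTwoStoreys.localSecondStorey_of_chartModel`).
[folklore; cite: Hartshorne1977, I §1 (affine coordinate changes)]
-/

-- single-problem summit: the doubled namespace component is forced
set_option linter.dupNamespace false

noncomputable section

namespace Summit.ResolutionOfSingularities.ResolutionOfSingularities.Theorems.FInjectiveMacaulayfication.FDStorey2ChartIso

open MvPolynomial
open Summit.ResolutionOfSingularities.ResolutionOfSingularities.Theorems.FInjectiveMacaulayfication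
open FDStorey1Fan FDStorey1PIdeal

variable (k : Type) [Field k]

/-- ★ `τ(g₂₇₇) = G` (characteristic 2), `τ : Y₂ ↦ Y₂ + 1`. [elementary computation] -/
theorem tau_evalL_G277 [CharP k 2] :
    aeval (fun i : Fin 5 => if i = 2 then (X 2 + 1 : MvPolynomial (Fin 5) k) else X i) (KLocCellKit.evalL k (G (277 : Fin 327))) =
      X 2 ^ 2 + X 0 ^ 3 + X 1 ^ 3 + X 3 * X 4 ^ 4 + X 3 ^ 2 * X 4 + X 2 * X 3 * X 4 ^ 4 + X 2 * X 3 ^ 2 * X 4 := by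
  have h2 : (2 : MvPolynomial (Fin 5) k) = 0 := (FermatCubicConeChar2.two_three k (n := 5)).1
  rw [FDStorey1PFedder.evalL_G277]
  simp only [map_add, map_mul, map_pow, map_one, aeval_X, Fin.reduceEq, if_true, if_false]
  linear_combination (X 2 + 1) * h2

/-- ★★ **The coordinate change.** A ring isomorphism `σ : k[Y]/(g₂₇₇) ≃+* k[Y]/(G)` induced by `τ`, with `σ (mk x) = mk (τ x)` and mapping `𝔪̄_P` onto the origin ideal.
[folklore] -/
theorem exists_chartEquiv [CharP k 2] (G₃ : MvPolynomial (Fin 5) k)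
    (hG₃ : G₃ = X 2 ^ 2 + X 0 ^ 3 + X 1 ^ 3 + X 3 * X 4 ^ 4 + X 3 ^ 2 * X 4 + X 2 * X 3 * X 4 ^ 4 + X 2 * X 3 ^ 2 * X 4) :
    ∃ σ : (MvPolynomial (Fin 5) k ⧸ Ideal.span {KLocCellKit.evalL k (G (277 : Fin 327))}) ≃+* (MvPolynomial (Fin 5) k ⧸ Ideal.span {G₃}),
      (∀ x : MvPolynomial (Fin 5) k, σ (Ideal.Quotient.mk _ x) =
        Ideal.Quotient.mk _ (aeval (fun i : Fin 5 => if i = 2 then (X 2 + 1 : MvPolynomial (Fin 5) k) else X i) x)) ∧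
      ((Ideal.span {x | x ∈ HS.map (KLocCellKit.evalL k)}).map (Ideal.Quotient.mk (Ideal.span {KLocCellKit.evalL k (G (277 : Fin 327))}))).map σ.toRingHom =
        Ideal.span (Set.range fun j : Fin 5 => Ideal.Quotient.mk (Ideal.span {G₃}) (X j)) := by
  set τ := aeval (R := k) (fun i : Fin 5 => if i = 2 then (X 2 + 1 : MvPolynomial (Fin 5) k) else X i) with hτ
  have hinv : Function.Involutive τ := tau_involutive k
  have hcomp : τ.comp τ = AlgHom.id k _ := AlgHom.ext fun p => hinv p
  let τE : MvPolynomial (Fin 5) k ≃ₐ[k] MvPolynomial (Fin 5) k := AlgEquiv.ofAlgHom τ τ hcomp hcomp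
  have hτE : ∀ x, τE x = τ x := fun _ => rfl
  have hIJ : Ideal.span {G₃} = (Ideal.span {KLocCellKit.evalL k (G (277 : Fin 327))}).map (τE.toRingEquiv : _ →+* _) := by
    rw [Ideal.map_span, Set.image_singleton]
    congr 1
    rw [Set.singleton_eq_singleton_iff, hG₃]
    exact (tau_evalL_G277 k).symm
  refine ⟨Ideal.quotientEquiv _ _ τE.toRingEquiv hIJ, fun x => rfl, ?_⟩
  -- the point ideal: `σ(mk 𝔪_P) = mk (τ 𝔪_P) = mk (τ τ 𝔪_origin) = mk 𝔪_origin`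
  rw [Ideal.map_map]
  have hcomp' : (Ideal.quotientEquiv _ _ τE.toRingEquiv hIJ).toRingHom.comp (Ideal.Quotient.mk (Ideal.span {KLocCellKit.evalL k (G (277 : Fin 327))})) =
      (Ideal.Quotient.mk (Ideal.span {G₃})).comp τ.toRingHom := by
    refine RingHom.ext fun x => ?_
    rfl
  have hid : τ.toRingHom.comp τ.toRingHom = RingHom.id _ := RingHom.ext fun p => hinv p
  rw [hcomp', span_HS_eq_map_tau, ← hτ, Ideal.map_map, RingHom.comp_assoc, hid, RingHom.comp_id, MvPolynomial.idealOfVars, Ideal.map_span,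
    ← Set.range_comp]
  rfl

/-- Hence, as POINTS: `σ⁻¹(origin of Spec k[Y]/(G)) = 𝔪̄_P` — the `hQ` input of ✓ `FHalfRowOfTwoStoreys.localSecondStorey_of_chartModel`. [folklore] -/
theorem comap_chartEquiv_origin [CharP k 2] (G₃ : MvPolynomial (Fin 5) k)
    (σ : (MvPolynomial (Fin 5) k ⧸ Ideal.span {KLocCellKit.evalL k (G (277 : Fin 327))}) ≃+* (MvPolynomial (Fin 5) k ⧸ Ideal.span {G₃}))
    (hσ : ((Ideal.span {x | x ∈ HS.map (KLocCellKit.evalL k)}).map (Ideal.Quotient.mk (Ideal.span {KLocCellKit.evalL k (G (277 : Fin 327))}))).map σ.toRingHom =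
        Ideal.span (Set.range fun j : Fin 5 => Ideal.Quotient.mk (Ideal.span {G₃}) (X j)))
    (P₀ : PrimeSpectrum (MvPolynomial (Fin 5) k ⧸ Ideal.span {KLocCellKit.evalL k (G (277 : Fin 327))}))
    (hP₀ : P₀.asIdeal = (Ideal.span {x | x ∈ HS.map (KLocCellKit.evalL k)}).map (Ideal.Quotient.mk (Ideal.span {KLocCellKit.evalL k (G (277 : Fin 327))})))
    (Q : PrimeSpectrum (MvPolynomial (Fin 5) k ⧸ Ideal.span {G₃}))
    (hQ : Q.asIdeal = Ideal.span (Set.range fun j : Fin 5 => Ideal.Quotient.mk (Ideal.span {G₃}) (X j))) :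
    Q.asIdeal.comap σ.toRingHom = P₀.asIdeal := by
  rw [hQ, hP₀, ← hσ]
  exact Ideal.comap_map_of_bijective σ.toRingHom σ.bijective

end Summit.ResolutionOfSingularities.ResolutionOfSingularities.Theorems.FInjectiveMacaulayfication.FDStorey2ChartIso

end
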